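import Mathlib
import Summits.AtomisticToContinuum.Crystallization.Theses.VdwKissingSutherland

/-!
# Route VdwKissingSutherland — the glue item `KissingStableGlue`

Item stmt-AtomisticToContinuum-12232 (support). Statement: `VdwKissing → SutherlandStable →` (the plain
Sutherland bound `Σ_i Σ_j dist(x i, x j)⁻⁶ ≤ N · L₆(hcp)` for every finite unit packing `x` of `ℝ³`).

Proof (finite-sum bookkeeping). For each site `i` the translated neighbour cloud
`{x j − x i : j ≠ i, dist(x i, x j) ≤ 3/2}` is a finite set of vectors with norms in `[1, 3/2]` and
pairwise distances `≥ 1` (translation invariance of `dist`), so `VdwKissing` bounds the two-shell sum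
`S_i` of site `i` by `51/4`; hence every deficit `51/4 − S_i` is non-negative, and dropping the
non-negative term `(1/10)·Σ_i (51/4 − S_i)` from `SutherlandStable` gives the bound.
-/

namespace Summit.AtomisticToContinuum.Crystallization.Theorems

open scoped BigOperators Classical
open Summit.AtomisticToContinuum.Crystallization.Theses.VdwKissingSutherland

/-- Per-site two-shell bound. Under `VdwKissing`, for a unit packing `x : Fin N → ℝ³`
(pairwise distances `≥ 1`) and a site `i`, the two-shell sum
`S_i = Σ_{j ≠ i, dist(x i, x j) ≤ 3/2} dist(x i, x j)⁻⁶` is at most `51/4`: apply `VdwKissing` to the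
image finset of `j ↦ x j − x i` (injective on a unit packing), whose members have norms in `[1, 3/2]`
and pairwise distances `≥ 1`. -/
theorem twoShellSum_le_of_vdwKissing (hK : VdwKissing) {N : ℕ}
    (x : Fin N → EuclideanSpace ℝ (Fin 3)) (hx : ∀ i j, i ≠ j → 1 ≤ dist (x i) (x j)) (i : Fin N) :
    ∑ j ∈ Finset.univ.filter (fun j => j ≠ i ∧ dist (x i) (x j) ≤ 3 / 2), (dist (x i) (x j))⁻¹ ^ 6
      ≤ 51 / 4 := by
  set T := Finset.univ.filter (fun j => j ≠ i ∧ dist (x i) (x j) ≤ 3 / 2) with hT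
  -- a unit packing is injective, so translation by `x i` is injective on the neighbour set
  have hinj : Set.InjOn (fun j => x j - x i) (T : Set (Fin N)) := by
    intro j _ k _ hjk
    by_contra hne
    have h1 := hx j k hne
    have hxjk : x j = x k := sub_left_injective hjk
    rw [hxjk, dist_self] at h1
    linarith
  have hsum : ∑ y ∈ T.image (fun j => x j - x i), ‖y‖⁻¹ ^ 6
      = ∑ j ∈ T, (dist (x i) (x j))⁻¹ ^ 6 := by
    rw [Finset.sum_image hinj]
    refine Finset.sum_congr rfl fun j _ => ?_
    rw [dist_comm, dist_eq_norm]
  rw [← hsum]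
  apply hK
  · -- norms in [1, 3/2]
    intro y hy
    obtain ⟨j, hj, rfl⟩ := Finset.mem_image.mp hy
    have hj' := (Finset.mem_filter.mp hj).2
    rw [← dist_eq_norm, dist_comm]
    exact ⟨hx i j (Ne.symm hj'.1), hj'.2⟩
  · -- pairwise distances ≥ 1 (translation invariance)
    intro y hy z hz hyz
    obtain ⟨j, hj, rfl⟩ := Finset.mem_image.mp hy
    obtain ⟨k, hk, rfl⟩ := Finset.mem_image.mp hz
    have hjk : j ≠ k := fun h => hyz (by rw [h])
    rw [dist_eq_norm, sub_sub_sub_cancel_right, ← dist_eq_norm]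
    exact hx j k hjk

/-- **The glue item `KissingStableGlue`** (stmt-AtomisticToContinuum-12232) of route
VdwKissingSutherland: `VdwKissing → SutherlandStable →` the plain Sutherland bound
`Σ_i Σ_j dist(x i, x j)⁻⁶ ≤ N · Σ'_{y ∈ hcp} ‖y‖⁻⁶` for every finite unit packing `x : Fin N → ℝ³`.
By `twoShellSum_le_of_vdwKissing` every two-shell deficit `51/4 − S_i` is non-negative, so the
deficit term of `SutherlandStable` can be dropped. -/
theorem kissingStableGlue_proof : KissingStableGlue := by
  unfold KissingStableGlue
  intro hK hS N x hx
  have h1 := hS N x hx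
  have h2 : 0 ≤ ∑ i, (51 / 4 - ∑ j ∈ Finset.univ.filter (fun j => j ≠ i ∧ dist (x i) (x j) ≤ 3 / 2),
      (dist (x i) (x j))⁻¹ ^ 6) := by
    refine Finset.sum_nonneg fun i _ => ?_
    have := twoShellSum_le_of_vdwKissing hK x hx i
    linarith
  linarith

end Summit.AtomisticToContinuum.Crystallization.Theorems
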